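import Summits.AtomisticToContinuum.Crystallization.Theorems.DisclinationRationAlphabetGoodHullElementStubHullZeroMeanStressTaylor
import Summits.AtomisticToContinuum.Crystallization.Theorems.HullExactificationCascadeHullBulkOptimal
import HarnessLib

/-!
# Stub `stub_hullZeroMeanStress` of line `census-liouville`, crux `AlphabetGoodHullElement`
# (route `DisclinationRation`, item stmt-AtomisticToContinuum-15798) — II: boundary bookkeeping

Helper file (ball level) for the zero-mean-stress stub, for a `δ`-separated `S ⊆ ℝ³`, a centre
`c`, a radius `L ≥ 1`, the finite set `Y = S ∩ B̄_L(c)` and the exterior `O = S ∖ B̄_L(c)`: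

* `hzms_crossSum_finset` — the landed surface bound `exists_crossSum_le`
  (`Σ_{inside} Σ_{outside} |y − z|⁻⁶ ≤ C L²` for finite configurations) reindexed to two finite
  subsets of `ℝ³`, and `hzms_cross_tsum_le` — its `tsum` form `Σ_{y ∈ Y} Σ'_{z ∈ O} |y − z|⁻⁶ ≤ C L²`
  (every finite part of `O` is a finite exterior set; `hzms_summable_inv_pow_six`);
* `hzms_tsum_split` — `Σ'_{z ∈ S, z ≠ y} f = Σ_{z ∈ Y, z ≠ y} f + Σ'_{z ∈ O} f` for `y ∈ Y`;
* `hzms_competitor` — for `|t|‖A‖ ≤ 1/2` the deformed points `y + tAy`, `y ∈ Y`, are distinct, so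
  `2 E(#Y) ≤ Σ_{y ≠ z ∈ Y} V(‖(y − z) + tA(y − z)‖)` (`groundStateEnergy_lennardJones_le`);
* `hzms_taylor_sum` — the pair Taylor estimate of part I summed over the ordered pairs of `Y`:
  `|G(t) − G(0) − tD| ≤ 2⁸(14(δ/2)⁻⁶ + 8)‖A‖² · 1024δ⁻⁶ · #Y · t²`.

All `[folklore]` (Blanc–Lewin 2015 §1.2–§1.3 for context).
-/

noncomputable section

namespace Summit.AtomisticToContinuum.Crystallization.Theorems.AlphabetGoodHullElementCensusLiouville

open scoped BigOperators RealInnerProductSpace Topology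
open Filter Set Metric
open Literature.MathematicalPhysics.StatisticalMechanics
open Summit.AtomisticToContinuum.Crystallization.Theorems.ExcessDecayLiouville
  (sum_inv_pow_le_of_separated)
open Summit.AtomisticToContinuum.Crystallization.Theorems.ExcessDecayLiouvilleFineGrains
  (exists_crossSum_le)

open Summit.AtomisticToContinuum.Crystallization.Theorems.CoarseGrains.Negative.PredicateAPI (E3)

/-! ## Boundary cross sums, splitting of site sums, the affine competitor, summed Taylor -/

/-- **Boundary cross sum of a separated set is a surface term (two finite sets).** For every
`δ > 0` there is `C ≥ 0` such that for disjoint finite `Y, F ⊆ ℝ³` with `Y ∪ F` `δ`-separated,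
`Y` inside and `F` outside the closed ball `B̄_L(c)` (`L ≥ 1`):
`Σ_{y ∈ Y} Σ_{z ∈ F} |y − z|⁻⁶ ≤ C L²` (the landed `exists_crossSum_le`, reindexed along an
enumeration of `Y ∪ F`). [folklore] -/
theorem hzms_crossSum_finset {δ : ℝ} (hδ : 0 < δ) : ∃ C : ℝ, 0 ≤ C ∧
    ∀ (Y F : Finset E3) (c : E3) (L : ℝ), 1 ≤ L → Disjoint Y F →
      (∀ a ∈ Y ∪ F, ∀ b ∈ Y ∪ F, a ≠ b → δ ≤ dist a b) →
      (∀ y ∈ Y, dist y c ≤ L) → (∀ z ∈ F, ¬ dist z c ≤ L) →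
      ∑ y ∈ Y, ∑ z ∈ F, (dist y z)⁻¹ ^ 6 ≤ C * L ^ 2 := by
  classical
  obtain ⟨C, hC⟩ := exists_crossSum_le δ hδ
  refine ⟨max C 0, le_max_right _ _, fun Y F c L hL hYF hsep hY hF => ?_⟩
  set W : Finset E3 := Y ∪ F with hW
  set e := W.equivFin with he
  set p : Fin W.card → E3 := fun i => ((e.symm i : {a // a ∈ W}) : E3) with hp
  have hpinj : Function.Injective p := fun i j h => e.symm.injective (Subtype.ext h)
  have hpmem : ∀ i, p i ∈ W := fun i => (e.symm i).2
  have hpsep : ∀ i j : Fin W.card, i ≠ j → δ ≤ dist (p i) (p j) := fun i j hij =>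
    hsep _ (hpmem i) _ (hpmem j) fun h => hij (hpinj h)
  set T : Finset (Fin W.card) := Finset.univ.filter fun i => dist (p i) c ≤ L with hT
  have hTiff : ∀ j, j ∈ T ↔ dist (p j) c ≤ L := fun j => by simp [hT]
  have key := hC W.card p hpinj hpsep c L hL T hTiff
  have hpe : ∀ (a : E3) (ha : a ∈ W), p (e ⟨a, ha⟩) = a := fun a ha => by
    simp only [hp, Equiv.symm_apply_apply]
  have himT : T.image p = Y := by
    ext a
    simp only [Finset.mem_image]
    constructor
    · rintro ⟨j, hj, rfl⟩
      rcases Finset.mem_union.1 (hpmem j) with h | h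
      · exact h
      · exact absurd ((hTiff j).1 hj) (hF _ h)
    · intro ha
      refine ⟨e ⟨a, Finset.mem_union_left _ ha⟩, (hTiff _).2 ?_, hpe a _⟩
      rw [hpe]
      exact hY a ha
  have himTc : Tᶜ.image p = F := by
    ext a
    simp only [Finset.mem_image, Finset.mem_compl]
    constructor
    · rintro ⟨j, hj, rfl⟩
      rcases Finset.mem_union.1 (hpmem j) with h | h
      · exact absurd (hY _ h) (fun h' => hj ((hTiff j).2 h'))
      · exact h
    · intro ha
      refine ⟨e ⟨a, Finset.mem_union_right _ ha⟩, fun h => hF a ha ?_, hpe a _⟩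
      have h' := (hTiff _).1 h
      rwa [hpe] at h'
  have hre : ∑ j ∈ T, ∑ l ∈ Tᶜ, (dist (p j) (p l))⁻¹ ^ 6 =
      ∑ y ∈ Y, ∑ z ∈ F, (dist y z)⁻¹ ^ 6 := by
    rw [← himT, ← himTc, Finset.sum_image fun a _ b _ h => hpinj h]
    refine Finset.sum_congr rfl fun j _ => ?_
    rw [Finset.sum_image fun a _ b _ h => hpinj h]
  rw [← hre]
  exact key.trans (mul_le_mul_of_nonneg_right (le_max_left _ _) (by positivity))

/-- **Inverse-sixth-power sums over a separated set are summable**, with the dyadic-shell bound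
`Σ'_{z ∈ T} |y − z|⁻⁶ ≤ 1024 δ⁻⁶` when `T` is `δ`-separated and `δ`-far from `y`
(`sum_inv_pow_le_of_separated` on every finite part). [folklore] -/
theorem hzms_summable_inv_pow_six {T : Set E3} {δ : ℝ} (hδ : 0 < δ) (y : E3)
    (hsep : ∀ a ∈ T, ∀ b ∈ T, a ≠ b → δ ≤ dist a b) (hfar : ∀ z ∈ T, δ ≤ dist y z) :
    Summable (fun z : T => (dist y (z : E3))⁻¹ ^ 6) ∧
      ∑' z : T, (dist y (z : E3))⁻¹ ^ 6 ≤ 1024 / (δ ^ 3 * δ ^ 3) := by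
  classical
  have hnn : 0 ≤ fun z : T => (dist y (z : E3))⁻¹ ^ 6 := fun z => by positivity
  have hbound : ∀ u : Finset T, ∑ z ∈ u, (dist y (z : E3))⁻¹ ^ 6 ≤ 1024 / (δ ^ 3 * δ ^ 3) := by
    intro u
    have h := sum_inv_pow_le_of_separated (u.image Subtype.val) y (k := 3) (by norm_num) hδ
      le_rfl ?_ ?_
    · rw [Finset.sum_image fun a _ b _ h => Subtype.ext h] at h
      refine le_trans (le_of_eq (Finset.sum_congr rfl fun z _ => ?_)) h
      rw [dist_comm]
    · intro a ha b hb hab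
      obtain ⟨a', -, rfl⟩ := Finset.mem_image.1 ha
      obtain ⟨b', -, rfl⟩ := Finset.mem_image.1 hb
      exact hsep _ a'.2 _ b'.2 hab
    · intro a ha
      obtain ⟨a', -, rfl⟩ := Finset.mem_image.1 ha
      rw [dist_comm]
      exact hfar _ a'.2
  exact ⟨summable_of_sum_le hnn hbound, Real.tsum_le_of_sum_le hnn hbound⟩

/-- `|Σ' f| ≤ Σ' g` when `|f| ≤ g` termwise and `g` is summable. [folklore] -/
theorem hzms_abs_tsum_le {ι : Type*} {f g : ι → ℝ} (hg : Summable g) (h : ∀ i, |f i| ≤ g i) :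
    |∑' i, f i| ≤ ∑' i, g i := by
  have hf : Summable fun i => ‖f i‖ :=
    Summable.of_nonneg_of_le (fun i => norm_nonneg _)
      (fun i => by rw [Real.norm_eq_abs]; exact h i) hg
  calc |∑' i, f i| = ‖∑' i, f i‖ := (Real.norm_eq_abs _).symm
    _ ≤ ∑' i, ‖f i‖ := norm_tsum_le_tsum_norm hf
    _ ≤ ∑' i, g i := hf.tsum_le_tsum (fun i => by rw [Real.norm_eq_abs]; exact h i) hg

/-- **Splitting a site sum at the sphere.** For `y` in the finite set `Yf = S ∩ B̄_L(c)` and `f`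
summable over the exterior `O = S ∖ B̄_L(c)`:
`Σ'_{z ∈ S, z ≠ y} f z = Σ_{z ∈ Yf, z ≠ y} f z + Σ'_{z ∈ O} f z`. [folklore] -/
theorem hzms_tsum_split {S : Set E3} {c : E3} {L : ℝ} {Yf : Finset E3}
    (hmemY : ∀ y : E3, y ∈ Yf ↔ y ∈ S ∧ dist y c ≤ L) {y : E3} (hy : y ∈ Yf) (f : E3 → ℝ)
    (hsum : Summable fun z : ↥({z : E3 | z ∈ S ∧ ¬ dist z c ≤ L} : Set E3) => f z) :
    ∑' z : ↥({z : E3 | z ∈ S ∧ z ≠ y} : Set E3), f z =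
      ∑ z ∈ Yf.erase y, f z + ∑' z : ↥({z : E3 | z ∈ S ∧ ¬ dist z c ≤ L} : Set E3), f z := by
  classical
  have hyL : dist y c ≤ L := ((hmemY y).1 hy).2
  have hset : ({z : E3 | z ∈ S ∧ z ≠ y} : Set E3) =
      (↑(Yf.erase y) : Set E3) ∪ {z : E3 | z ∈ S ∧ ¬ dist z c ≤ L} := by
    ext z
    simp only [Set.mem_setOf_eq, Set.mem_union, Finset.mem_coe, Finset.mem_erase]
    constructor
    · rintro ⟨hzS, hzy⟩
      by_cases h : dist z c ≤ L
      · exact Or.inl ⟨hzy, (hmemY z).2 ⟨hzS, h⟩⟩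
      · exact Or.inr ⟨hzS, h⟩
    · rintro (⟨hzy, hz⟩ | ⟨hzS, h⟩)
      · exact ⟨((hmemY z).1 hz).1, hzy⟩
      · exact ⟨hzS, fun hzy => h (hzy ▸ hyL)⟩
  have hdisj : Disjoint (↑(Yf.erase y) : Set E3) {z : E3 | z ∈ S ∧ ¬ dist z c ≤ L} := by
    rw [Set.disjoint_left]
    intro z hz hz'
    have hz1 : z ∈ Yf := Finset.mem_of_mem_erase (Finset.mem_coe.1 hz)
    exact hz'.2 ((hmemY z).1 hz1).2
  rw [tsum_congr_set_coe f hset, Summable.tsum_union_disjoint hdisj ((Yf.erase y).summable f) hsum,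
    Finset.tsum_subtype']

/-- **Joint boundary bound for the site sums of a separated set.** For a `δ`-separated `S`,
`L ≥ 1`, `Yf = S ∩ B̄_L(c)` and the exterior `O = S ∖ B̄_L(c)`:
`Σ_{y ∈ Yf} Σ'_{z ∈ O} |y − z|⁻⁶ ≤ C L²`, `C` the constant of `hzms_crossSum_finset` (every finite
part of `O` is a finite exterior set). [folklore] -/
theorem hzms_cross_tsum_le {S : Set E3} {δ : ℝ} (hδ : 0 < δ)
    (hsep : ∀ a ∈ S, ∀ b ∈ S, a ≠ b → δ ≤ dist a b) {c : E3} {L : ℝ} (hL : 1 ≤ L)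
    {Yf : Finset E3} (hmemY : ∀ y : E3, y ∈ Yf ↔ y ∈ S ∧ dist y c ≤ L) {C : ℝ}
    (hC : ∀ (Y F : Finset E3) (c : E3) (L : ℝ), 1 ≤ L → Disjoint Y F →
      (∀ a ∈ Y ∪ F, ∀ b ∈ Y ∪ F, a ≠ b → δ ≤ dist a b) →
      (∀ y ∈ Y, dist y c ≤ L) → (∀ z ∈ F, ¬ dist z c ≤ L) →
      ∑ y ∈ Y, ∑ z ∈ F, (dist y z)⁻¹ ^ 6 ≤ C * L ^ 2) :
    ∑ y ∈ Yf, ∑' z : ↥({z : E3 | z ∈ S ∧ ¬ dist z c ≤ L} : Set E3), (dist y (z : E3))⁻¹ ^ 6 ≤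
      C * L ^ 2 := by
  classical
  set O : Set E3 := {z : E3 | z ∈ S ∧ ¬ dist z c ≤ L} with hO
  have hYS : ∀ y ∈ Yf, y ∈ S := fun y hy => ((hmemY y).1 hy).1
  have hsepO : ∀ p ∈ O, ∀ q ∈ O, p ≠ q → δ ≤ dist p q := fun p hp q hq hpq =>
    hsep p hp.1 q hq.1 hpq
  have hfar : ∀ y ∈ Yf, ∀ z ∈ O, δ ≤ dist y z := fun y hy z hz =>
    hsep y (hYS y hy) z hz.1 fun h => hz.2 (h ▸ ((hmemY y).1 hy).2)
  have hsum : ∀ y ∈ Yf, Summable fun z : O => (dist y (z : E3))⁻¹ ^ 6 := fun y hy =>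
    (hzms_summable_inv_pow_six hδ y hsepO (hfar y hy)).1
  rw [← Summable.tsum_finsetSum hsum]
  refine Real.tsum_le_of_sum_le (fun z => Finset.sum_nonneg fun y _ => by positivity) fun u => ?_
  rw [Finset.sum_comm]
  have himg : ∀ y : E3, ∑ z ∈ u, (dist y ((z : O) : E3))⁻¹ ^ 6 =
      ∑ z ∈ u.image Subtype.val, (dist y z)⁻¹ ^ 6 := fun y => by
    rw [Finset.sum_image fun a _ b _ h => Subtype.ext h]
  rw [Finset.sum_congr rfl fun y _ => himg y]
  refine hC Yf (u.image Subtype.val) c L hL ?_ ?_ (fun y hy => ((hmemY y).1 hy).2) ?_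
  · rw [Finset.disjoint_left]
    intro z hzY hzF
    obtain ⟨z', -, rfl⟩ := Finset.mem_image.1 hzF
    exact z'.2.2 ((hmemY _).1 hzY).2
  · have hmemS : ∀ p ∈ Yf ∪ u.image Subtype.val, p ∈ S := fun p hp => by
      rcases Finset.mem_union.1 hp with h | h
      · exact hYS p h
      · obtain ⟨p', -, rfl⟩ := Finset.mem_image.1 h
        exact p'.2.1
    exact fun p hp q hq hpq => hsep p (hmemS p hp) q (hmemS q hq) hpq
  · intro z hz
    obtain ⟨z', -, rfl⟩ := Finset.mem_image.1 hz
    exact z'.2.2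

/-- Reindexing a sum over `Fin #Y` along `Y.equivFin`. [folklore] -/
theorem hzms_sum_fin_eq (Y : Finset E3) (F : E3 → ℝ) :
    ∑ k : Fin Y.card, F ((Y.equivFin.symm k : {a // a ∈ Y}) : E3) = ∑ a ∈ Y, F a := by
  rw [← Finset.sum_coe_sort Y F]
  exact Fintype.sum_equiv Y.equivFin.symm _ _ fun _ => rfl

/-- **The affine competitor.** For `|t| ‖A‖ ≤ 1/2` the points `y + tAy`, `y ∈ Y`, are distinct
(`‖(y − z) + tA(y − z)‖ ≥ ‖y − z‖/2`), so their double interaction sum is at least `2 E(#Y)`: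
`2 E(#Y) ≤ Σ_{y ≠ z ∈ Y} V(‖(y − z) + tA(y − z)‖)` (`groundStateEnergy_lennardJones_le`,
`two_mul_interactionEnergy_eq_sum_sum`, `V(0) = 0` on the diagonal). [folklore] -/
theorem hzms_competitor (A : E3 →L[ℝ] E3) {t : ℝ} (ht : |t| * ‖A‖ ≤ 1 / 2) (Y : Finset E3) :
    2 * groundStateEnergy lennardJones 3 Y.card ≤
      ∑ y ∈ Y, ∑ z ∈ Y.erase y, lennardJones ‖(y - z) + t • A (y - z)‖ := by
  classical
  set q : Fin Y.card → E3 := fun i => ((Y.equivFin.symm i : {a // a ∈ Y}) : E3) with hq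
  have hqinj : Function.Injective q := fun i j h => Y.equivFin.symm.injective (Subtype.ext h)
  set p : Fin Y.card → E3 := fun i => q i + t • A (q i) with hp
  have hdist : ∀ i k, dist (p i) (p k) = ‖(q i - q k) + t • A (q i - q k)‖ := fun i k =>
    hzms_dist_affine A t (q i) (q k)
  have hpinj : Function.Injective p := by
    intro i k hik
    apply hqinj
    have h2 := hzms_half_norm_le_norm_affine A ht (q i - q k)
    rw [← hdist, hik, dist_self] at h2
    have h3 : ‖q i - q k‖ = 0 := le_antisymm (by linarith) (norm_nonneg _)
    exact sub_eq_zero.1 (norm_eq_zero.1 h3)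
  have hE := groundStateEnergy_lennardJones_le (d := 3) hpinj
  have h2 := two_mul_interactionEnergy_eq_sum_sum lennardJones lennardJones_zero p
  have hre : ∑ i, ∑ k, lennardJones (dist (p i) (p k)) =
      ∑ y ∈ Y, ∑ z ∈ Y, lennardJones ‖(y - z) + t • A (y - z)‖ := by
    simp_rw [hdist]
    have inner : ∀ i, ∑ k, lennardJones ‖(q i - q k) + t • A (q i - q k)‖ =
        ∑ z ∈ Y, lennardJones ‖(q i - z) + t • A (q i - z)‖ := fun i =>
      hzms_sum_fin_eq Y fun z => lennardJones ‖(q i - z) + t • A (q i - z)‖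
    simp_rw [inner]
    exact hzms_sum_fin_eq Y fun y => ∑ z ∈ Y, lennardJones ‖(y - z) + t • A (y - z)‖
  have hdiag : ∀ y ∈ Y, ∑ z ∈ Y, lennardJones ‖(y - z) + t • A (y - z)‖ =
      ∑ z ∈ Y.erase y, lennardJones ‖(y - z) + t • A (y - z)‖ := fun y hy => by
    rw [← Finset.add_sum_erase Y _ hy]
    simp [lennardJones_zero]
  calc 2 * groundStateEnergy lennardJones 3 Y.card ≤ 2 * interactionEnergy lennardJones p := by
        linarith
    _ = ∑ y ∈ Y, ∑ z ∈ Y, lennardJones ‖(y - z) + t • A (y - z)‖ := by rw [h2, hre]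
    _ = _ := Finset.sum_congr rfl hdiag

/-- **Summed Taylor estimate.** For a `δ`-separated finite `Y`, `t₀ ‖A‖ ≤ 1/2` and `|t| ≤ t₀`,
with `G(t) = Σ_{y ≠ z ∈ Y} V(‖(y − z) + tA(y − z)‖)` and
`D = Σ_{y ≠ z ∈ Y} V′(‖y − z‖)/‖y − z‖ · ⟪y − z, A(y − z)⟫`:
`|G(t) − G(0) − t D| ≤ 2⁸(14(δ/2)⁻⁶ + 8)‖A‖² · 1024 δ⁻⁶ · #Y · t²`
(`hzms_pair_taylor` termwise, `Σ_{z ≠ y} ‖y − z‖⁻⁶ ≤ 1024 δ⁻⁶`). [folklore] -/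
theorem hzms_taylor_sum (A : E3 →L[ℝ] E3) {δ : ℝ} (hδ : 0 < δ) {t₀ : ℝ}
    (ht₀ : t₀ * ‖A‖ ≤ 1 / 2) (Y : Finset E3)
    (hsep : ∀ a ∈ Y, ∀ b ∈ Y, a ≠ b → δ ≤ dist a b) {t : ℝ} (ht : |t| ≤ t₀) :
    |∑ y ∈ Y, ∑ z ∈ Y.erase y, lennardJones ‖(y - z) + t • A (y - z)‖ -
        ∑ y ∈ Y, ∑ z ∈ Y.erase y, lennardJones ‖y - z‖ -
        t * ∑ y ∈ Y, ∑ z ∈ Y.erase y,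
          (deriv lennardJones ‖y - z‖ / ‖y - z‖ * ⟪y - z, A (y - z)⟫)| ≤
      2 ^ 8 * (14 * (δ / 2)⁻¹ ^ 6 + 8) * ‖A‖ ^ 2 * (1024 / (δ ^ 3 * δ ^ 3)) * Y.card * t ^ 2 := by
  classical
  set K₂ : ℝ := 2 ^ 8 * (14 * (δ / 2)⁻¹ ^ 6 + 8) * ‖A‖ ^ 2 with hK₂
  have hK₂0 : 0 ≤ K₂ := by positivity
  have hcomb : ∑ y ∈ Y, ∑ z ∈ Y.erase y, lennardJones ‖(y - z) + t • A (y - z)‖ -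
        ∑ y ∈ Y, ∑ z ∈ Y.erase y, lennardJones ‖y - z‖ -
        t * ∑ y ∈ Y, ∑ z ∈ Y.erase y,
          (deriv lennardJones ‖y - z‖ / ‖y - z‖ * ⟪y - z, A (y - z)⟫) =
      ∑ y ∈ Y, ∑ z ∈ Y.erase y, (lennardJones ‖(y - z) + t • A (y - z)‖ -
        lennardJones ‖y - z‖ - t * (deriv lennardJones ‖y - z‖ / ‖y - z‖ * ⟪y - z, A (y - z)⟫)) := by
    simp only [Finset.sum_sub_distrib, Finset.mul_sum]
  rw [hcomb]
  have hterm : ∀ y ∈ Y, ∀ z ∈ Y.erase y,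
      |lennardJones ‖(y - z) + t • A (y - z)‖ - lennardJones ‖y - z‖ -
        t * (deriv lennardJones ‖y - z‖ / ‖y - z‖ * ⟪y - z, A (y - z)⟫)| ≤
      K₂ * ‖y - z‖⁻¹ ^ 6 * t ^ 2 := fun y hy z hz => by
    have hne : z ≠ y := Finset.ne_of_mem_erase hz
    have hzY : z ∈ Y := Finset.mem_of_mem_erase hz
    have hu : δ ≤ ‖y - z‖ := by
      rw [← dist_eq_norm]
      exact hsep y hy z hzY hne.symm
    exact hzms_pair_taylor A hδ ht₀ hu ht
  have hinner : ∀ y ∈ Y, ∑ z ∈ Y.erase y, ‖y - z‖⁻¹ ^ 6 ≤ 1024 / (δ ^ 3 * δ ^ 3) := fun y hy => by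
    have h := sum_inv_pow_le_of_separated (Y.erase y) y (k := 3) (by norm_num) hδ le_rfl
      (fun a ha b hb hab => hsep a (Finset.mem_of_mem_erase ha) b (Finset.mem_of_mem_erase hb) hab)
      (fun a ha => hsep a (Finset.mem_of_mem_erase ha) y hy (Finset.ne_of_mem_erase ha))
    refine le_trans (le_of_eq (Finset.sum_congr rfl fun z _ => ?_)) h
    rw [dist_comm, dist_eq_norm]
  calc |∑ y ∈ Y, ∑ z ∈ Y.erase y, (lennardJones ‖(y - z) + t • A (y - z)‖ -
          lennardJones ‖y - z‖ - t * (deriv lennardJones ‖y - z‖ / ‖y - z‖ * ⟪y - z, A (y - z)⟫))|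
      ≤ ∑ y ∈ Y, |∑ z ∈ Y.erase y, (lennardJones ‖(y - z) + t • A (y - z)‖ -
          lennardJones ‖y - z‖ - t * (deriv lennardJones ‖y - z‖ / ‖y - z‖ * ⟪y - z, A (y - z)⟫))| :=
        Finset.abs_sum_le_sum_abs _ _
    _ ≤ ∑ y ∈ Y, ∑ z ∈ Y.erase y, |lennardJones ‖(y - z) + t • A (y - z)‖ -
          lennardJones ‖y - z‖ - t * (deriv lennardJones ‖y - z‖ / ‖y - z‖ * ⟪y - z, A (y - z)⟫)| :=
        Finset.sum_le_sum fun y _ => Finset.abs_sum_le_sum_abs _ _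
    _ ≤ ∑ y ∈ Y, ∑ z ∈ Y.erase y, K₂ * ‖y - z‖⁻¹ ^ 6 * t ^ 2 :=
        Finset.sum_le_sum fun y hy => Finset.sum_le_sum fun z hz => hterm y hy z hz
    _ = ∑ y ∈ Y, K₂ * t ^ 2 * ∑ z ∈ Y.erase y, ‖y - z‖⁻¹ ^ 6 := by
        refine Finset.sum_congr rfl fun y _ => ?_
        rw [Finset.mul_sum]
        exact Finset.sum_congr rfl fun z _ => by ring
    _ ≤ ∑ y ∈ Y, K₂ * t ^ 2 * (1024 / (δ ^ 3 * δ ^ 3)) :=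
        Finset.sum_le_sum fun y hy => mul_le_mul_of_nonneg_left (hinner y hy) (by positivity)
    _ = K₂ * (1024 / (δ ^ 3 * δ ^ 3)) * Y.card * t ^ 2 := by
        rw [Finset.sum_const, nsmul_eq_mul]
        ring

end Summit.AtomisticToContinuum.Crystallization.Theorems.AlphabetGoodHullElementCensusLiouville

end
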